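import Summits.Ventures.Crystal3D.Theorems.StickyWulffConstantTextureBuildRiserHexagons
import Summits.Ventures.Crystal3D.Theorems.StickyWulffConstantTextureBuildRiserLine
import Summits.Ventures.Crystal3D.Theorems.StickyWulffConstantTextureBuildBarlowShells
import Summits.Ventures.Crystal3D.Theorems.StickyWulffConstantCoaxialWallLawFrame
import Literature.MathematicalPhysics.StatisticalMechanics.BarlowCovering
import HarnessLib

/-!
# The RISER PACKAGE (B6), part 4: SITES of the riser frame — neighbours, the hexagon COVERING (Voronoi), the opposite-letter vertex of a riser layer
# (lane T, crux `TextureLiminfV5`, stmt-Ventures-23912; design memo HOME/wulff-p2/g21/B6-DESIGN-g21.md §2–§3; target `RiserPackage₇` of '…TextureBuildMeshV7')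

HONEST FRAMING. Venture `Summits/Ventures/Crystal3D` (cell `crystal3d-full`), route `route-Ventures-StickyWulffConstant`, helper `--supports` the
law-v5 crux `TextureLiminfV5` (stmt-Ventures-23912).  Lattice geometry of the two column stackings in the riser frame of '…RiserFrameDefs' (census-free,
standard axioms); nothing about cells, contacts or curtains yet; F-C1 not moved.

* `site r m i j` / `siteR r m i j` — the `f`- / `g`-sites of layer `m` (`f = rtL r`, `g = rtR r`); `site_mem`, `rheight_site`, `rlayer_site`, `exists_eq_site`;
  the six in-plane neighbours `site_add_sixDir`;
* `inplane` — the squared in-plane distance `‖y − c‖² − ⟪rL e₃, y − c⟫²`; `hexagon_or_closer` (a failed wall inequality gives a strictly closer neighbour);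
  **`exists_site_hexagon`** — THE COVERING: every point lies in the closed hexagon (apothem `½`) of some `f`-site of any given layer, within in-plane
  distance `1/√3` (lit covering radius + a three-step descent closed by the 120° lemma `card_le_three_of_norm_sub_sq_le_third` of …RiserLine);
* `exists_siteR_dist_sq` — in a RISER layer every `f`-site has a `g`-site at squared distance `1/3` (the letters differ `mod 3`);
  `exists_site_eq_siteR` — in a SHARED layer the `g`-sites are `f`-sites.
-/

noncomputable section

open scoped BigOperators InnerProductSpace

namespace Summit.Ventures.Crystal3D.Cruxes.TextureLiminf.TexShadow

open Summit.Ventures.Crystal3D Summit.Ventures.Crystal3D.Theorems Set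
open Summit.Ventures.Crystal3D.TentCertificate (height hB hB_pos hB_sq height_move)
open Literature.MathematicalPhysics.StatisticalMechanics (IsHaggSeq barlowStacking barlowPos barlowLayer barlowOffset triangularVec₁ triangularVec₂
  layerNormal haggLabel barlowPos_mem barlowPos_apply_two three_smul_barlowOffset exists_barlowPos_inPlane_dist_sq_le)

/-- `⟪e₃, w⟫` in coordinates. -/
private theorem inner_e₃_left (w : E3) : ⟪e₃, w⟫_ℝ = w 2 := by
  rw [e₃, EuclideanSpace.inner_single_left]; simp

/-- `‖w‖²` in coordinates. -/
private theorem norm_sq_coords (w : E3) : ‖w‖ ^ 2 = w 0 ^ 2 + w 1 ^ 2 + w 2 ^ 2 := by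
  rw [EuclideanSpace.norm_sq_eq, Fin.sum_univ_three]
  simp [Real.norm_eq_abs, sq_abs]

/-- `‖w‖² = 1/3` for the letter offset. -/
theorem norm_barlowOffset_sq : ‖(barlowOffset 1 : E3)‖ ^ 2 = 1 / 3 := by
  rw [norm_sq_coords]
  have h3 : Real.sqrt 3 ^ 2 = 3 := Real.sq_sqrt (by norm_num)
  simp [barlowOffset]
  nlinarith [h3]

/-- A letter shift by `3q + δ` is the in-layer translation by `q (u + v)` plus `δ` letter offsets. -/
theorem barlowPos_eq_of_haggLabel_eq_add {s s' : ℤ → ℤ} {k q δ : ℤ} (hL : haggLabel s' k = haggLabel s k + 3 * q + δ) (i j : ℤ) :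
    barlowPos 1 hB s' k i j = barlowPos 1 hB s k (i + q) (j + q) + (δ : ℝ) • barlowOffset 1 := by
  ext l
  fin_cases l <;> simp [barlowPos, hL, triangularVec₁, triangularVec₂, barlowOffset, layerNormal] <;> ring

namespace Mesh₅

variable {C R₀ : ℝ} {N : ℕ} {x : Fin N → E3} {rc : RiseredCover C R₀ N x} {δ : ℝ} (μ : Mesh₅ rc δ)

/-! ### Sites of the riser frame -/

/-- the `f`-site `(m, i, j)` of box `r`'s riser frame (`f = rtL r`) -/
def site (r : Fin rc.nr) (m i j : ℤ) : E3 := μ.rL r (barlowPos 1 hB (μ.rσL r) m i j) + μ.rs r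

/-- the `g`-site `(m, i, j)` of box `r`'s riser frame (`g = rtR r`) -/
def siteR (r : Fin rc.nr) (m i j : ℤ) : E3 := μ.rL r (barlowPos 1 hB (μ.rσR r) m i j) + μ.rs r

/-- `f`-sites are sites of `S f`. -/
theorem site_mem (r : Fin rc.nr) (m i j : ℤ) : μ.site r m i j ∈ rc.S (rc.rtL r) := by
  rw [(μ.rframe_spec r).2.2.1]; exact ⟨_, barlowPos_mem _ _ _, rfl⟩

/-- `g`-sites are sites of `S g`. -/
theorem siteR_mem (r : Fin rc.nr) (m i j : ℤ) : μ.siteR r m i j ∈ rc.S (rc.rtR r) := by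
  rw [(μ.rframe_spec r).2.2.2.1]; exact ⟨_, barlowPos_mem _ _ _, rfl⟩

/-- The height of an `f`-site. -/
theorem rheight_site (r : Fin rc.nr) (m i j : ℤ) : μ.rheight r (μ.site r m i j) = (m : ℝ) * hB := by
  unfold rheight site; rw [height_move, barlowPos_apply_two]

/-- The height of a `g`-site. -/
theorem rheight_siteR (r : Fin rc.nr) (m i j : ℤ) : μ.rheight r (μ.siteR r m i j) = (m : ℝ) * hB := by
  unfold rheight siteR; rw [height_move, barlowPos_apply_two]

/-- The layer index of an `f`-site. -/
theorem rlayer_site (r : Fin rc.nr) (m i j : ℤ) : μ.rlayer r (μ.site r m i j) = m := by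
  unfold rlayer; rw [rheight_site, mul_div_assoc, div_self hB_pos.ne', mul_one, Int.floor_intCast]

/-- Every site of `S f` is an `f`-site of the riser frame. -/
theorem exists_eq_site {r : Fin rc.nr} {q : E3} (hq : q ∈ rc.S (rc.rtL r)) : ∃ m i j, q = μ.site r m i j := by
  rw [(μ.rframe_spec r).2.2.1] at hq
  obtain ⟨p, ⟨m, i, j, rfl⟩, rfl⟩ := hq
  exact ⟨m, i, j, rfl⟩

/-- Every site of `S g` is a `g`-site of the riser frame. -/
theorem exists_eq_siteR {r : Fin rc.nr} {q : E3} (hq : q ∈ rc.S (rc.rtR r)) : ∃ m i j, q = μ.siteR r m i j := by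
  rw [(μ.rframe_spec r).2.2.2.1] at hq
  obtain ⟨p, ⟨m, i, j, rfl⟩, rfl⟩ := hq
  exact ⟨m, i, j, rfl⟩

/-! ### The six in-plane neighbours -/

/-- Shift `i ↦ i + 1`. -/
theorem site_succ_i (r : Fin rc.nr) (m i j : ℤ) : μ.site r m (i + 1) j = μ.site r m i j + μ.rL r (triangularVec₁ 1) := by
  unfold site; rw [barlowPos_succ_i, map_add]; abel

/-- Shift `j ↦ j + 1`. -/
theorem site_succ_j (r : Fin rc.nr) (m i j : ℤ) : μ.site r m i (j + 1) = μ.site r m i j + μ.rL r (triangularVec₂ 1) := by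
  unfold site; rw [barlowPos_succ_j, map_add]; abel

/-- Shift `i ↦ i − 1`. -/
theorem site_pred_i (r : Fin rc.nr) (m i j : ℤ) : μ.site r m (i - 1) j = μ.site r m i j - μ.rL r (triangularVec₁ 1) := by
  have h := μ.site_succ_i r m (i - 1) j
  rw [sub_add_cancel] at h
  rw [h, add_sub_cancel_right]

/-- Shift `j ↦ j − 1`. -/
theorem site_pred_j (r : Fin rc.nr) (m i j : ℤ) : μ.site r m i (j - 1) = μ.site r m i j - μ.rL r (triangularVec₂ 1) := by
  have h := μ.site_succ_j r m i (j - 1)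
  rw [sub_add_cancel] at h
  rw [h, add_sub_cancel_right]

/-- **The six in-plane neighbours are sites of the same layer.** -/
theorem site_add_sixDir (r : Fin rc.nr) (m i j : ℤ) (t : Fin 6) : ∃ i' j', μ.site r m i j + μ.rL r (sixDir t) = μ.site r m i' j' := by
  have h0 : μ.site r m i j + μ.rL r (sixDir 0) = μ.site r m (i + 1) j := by rw [sixDir_zero, μ.site_succ_i]
  have h1 : μ.site r m i j + μ.rL r (sixDir 1) = μ.site r m i (j + 1) := by rw [sixDir_one, μ.site_succ_j]
  have h2 : μ.site r m i j + μ.rL r (sixDir 2) = μ.site r m (i - 1) (j + 1) := by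
    rw [sixDir_two, μ.site_succ_j, μ.site_pred_i, map_sub]; abel
  have h3 : μ.site r m i j + μ.rL r (sixDir 3) = μ.site r m (i - 1) j := by rw [sixDir_three, μ.site_pred_i, map_neg]; abel
  have h4 : μ.site r m i j + μ.rL r (sixDir 4) = μ.site r m i (j - 1) := by rw [sixDir_four, μ.site_pred_j, map_neg]; abel
  have h5 : μ.site r m i j + μ.rL r (sixDir 5) = μ.site r m (i + 1) (j - 1) := by
    rw [sixDir_five, μ.site_pred_j, μ.site_succ_i, map_sub]; abel
  fin_cases t
  · exact ⟨_, _, h0⟩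
  · exact ⟨_, _, h1⟩
  · exact ⟨_, _, h2⟩
  · exact ⟨_, _, h3⟩
  · exact ⟨_, _, h4⟩
  · exact ⟨_, _, h5⟩

/-! ### The hexagon covering -/

/-- A failed wall inequality gives a strictly closer neighbour (in-plane). -/
theorem hexagon_or_closer (r : Fin rc.nr) (m i j : ℤ) (y : E3) :
    (∀ t, ⟪μ.rL r (sixDir t), y - μ.site r m i j⟫_ℝ ≤ 1 / 2) ∨
      ∃ i' j', ‖y - μ.site r m i' j'‖ ^ 2 - ⟪μ.rL r e₃, y - μ.site r m i' j'⟫_ℝ ^ 2 <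
        ‖y - μ.site r m i j‖ ^ 2 - ⟪μ.rL r e₃, y - μ.site r m i j⟫_ℝ ^ 2 := by
  by_cases h : ∀ t, ⟪μ.rL r (sixDir t), y - μ.site r m i j⟫_ℝ ≤ 1 / 2
  · exact Or.inl h
  · right
    push Not at h
    obtain ⟨t, ht⟩ := h
    obtain ⟨i', j', he⟩ := μ.site_add_sixDir r m i j t
    refine ⟨i', j', ?_⟩
    have hsub : y - μ.site r m i' j' = (y - μ.site r m i j) - μ.rL r (sixDir t) := by rw [← he]; abel
    have hn : ‖μ.rL r (sixDir t)‖ = 1 := by rw [LinearIsometryEquiv.norm_map, norm_sixDir]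
    have horth : ⟪μ.rL r e₃, μ.rL r (sixDir t)⟫_ℝ = 0 := by
      rw [LinearIsometryEquiv.inner_map_map, real_inner_comm, inner_sixDir_e₃]
    rw [hsub, inner_sub_right, horth, sub_zero, norm_sub_sq_real, hn, real_inner_comm]
    linarith

/-- The in-plane squared distance to a site of layer `m` equals the squared distance to the projected point. -/
theorem norm_sub_proj_sq (r : Fin rc.nr) {m i j : ℤ} (y : E3) :
    ‖μ.site r m i j - (y - (μ.rheight r y - (m : ℝ) * hB) • μ.rL r e₃)‖ ^ 2 =
      ‖y - μ.site r m i j‖ ^ 2 - ⟪μ.rL r e₃, y - μ.site r m i j⟫_ℝ ^ 2 := by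
  set w := y - μ.site r m i j with hw
  have hl : ⟪μ.rL r e₃, w⟫_ℝ = μ.rheight r y - (m : ℝ) * hB := by
    rw [hw, inner_sub_right, ← μ.rheight_site r m i j, μ.rheight_eq r, μ.rheight_eq r, μ.rn_eq r]; ring
  have hn : ‖μ.rL r e₃‖ = 1 := norm_frame_e₃ _
  have he : μ.site r m i j - (y - (μ.rheight r y - (m : ℝ) * hB) • μ.rL r e₃) = -(w - ⟪μ.rL r e₃, w⟫_ℝ • μ.rL r e₃) := by
    rw [hl, hw]; abel
  rw [he, norm_neg, norm_sub_sq_real, norm_smul, hn, mul_one, Real.norm_eq_abs, sq_abs, inner_smul_right, real_inner_comm]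
  ring

/-- **THE HEXAGON COVERING**: every point lies in the closed hexagon (apothem `½`) of some `f`-site of layer `m`, within in-plane distance `1/√3`. -/
theorem exists_site_hexagon (r : Fin rc.nr) (m : ℤ) (y : E3) :
    ∃ i j, (∀ t, ⟪μ.rL r (sixDir t), y - μ.site r m i j⟫_ℝ ≤ 1 / 2) ∧
      ‖y - μ.site r m i j‖ ^ 2 - ⟪μ.rL r e₃, y - μ.site r m i j⟫_ℝ ^ 2 ≤ 1 / 3 := by
  -- the in-plane squared distance as a function of the site
  set IP : ℤ → ℤ → ℝ := fun i j => ‖y - μ.site r m i j‖ ^ 2 - ⟪μ.rL r e₃, y - μ.site r m i j⟫_ℝ ^ 2 with hIP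
  -- a candidate within `1/√3` (lit covering radius of the layer)
  set q := (μ.rL r).symm (y - μ.rs r) with hq
  obtain ⟨i₀, j₀, h₀⟩ := exists_barlowPos_inPlane_dist_sq_le (a := (1 : ℝ)) one_ne_zero hB (μ.rσL r) m q
  have hIP₀ : IP i₀ j₀ ≤ 1 / 3 := by
    have hy : y - μ.site r m i₀ j₀ = μ.rL r (q - barlowPos 1 hB (μ.rσL r) m i₀ j₀) := by
      rw [map_sub, hq, LinearIsometryEquiv.apply_symm_apply]; unfold site; abel
    simp only [hIP]
    rw [hy, LinearIsometryEquiv.norm_map, LinearIsometryEquiv.inner_map_map, inner_e₃_left, norm_sq_coords]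
    simp only [PiLp.sub_apply]
    nlinarith [h₀]
  -- three descent steps; a fourth site within `1/√3` of the projected point is impossible (120° lemma)
  rcases μ.hexagon_or_closer r m i₀ j₀ y with h | ⟨i₁, j₁, hlt₁⟩
  · exact ⟨i₀, j₀, h, hIP₀⟩
  rcases μ.hexagon_or_closer r m i₁ j₁ y with h | ⟨i₂, j₂, hlt₂⟩
  · exact ⟨i₁, j₁, h, by simp only [hIP] at hIP₀; linarith⟩
  rcases μ.hexagon_or_closer r m i₂ j₂ y with h | ⟨i₃, j₃, hlt₃⟩
  · exact ⟨i₂, j₂, h, by simp only [hIP] at hIP₀; linarith⟩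
  rcases μ.hexagon_or_closer r m i₃ j₃ y with h | ⟨i₄, j₄, hlt₄⟩
  · exact ⟨i₃, j₃, h, by simp only [hIP] at hIP₀; linarith⟩
  exfalso
  simp only [hIP] at hIP₀
  set c₀ := μ.site r m i₀ j₀
  set c₁ := μ.site r m i₁ j₁
  set c₂ := μ.site r m i₂ j₂
  set c₃ := μ.site r m i₃ j₃
  set z' := y - (μ.rheight r y - (m : ℝ) * hB) • μ.rL r e₃ with hz'
  have hd₀ : ‖c₀ - z'‖ ^ 2 ≤ 1 / 3 := by rw [μ.norm_sub_proj_sq r y]; linarith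
  have hd₁ : ‖c₁ - z'‖ ^ 2 ≤ 1 / 3 := by rw [μ.norm_sub_proj_sq r y]; linarith
  have hd₂ : ‖c₂ - z'‖ ^ 2 ≤ 1 / 3 := by rw [μ.norm_sub_proj_sq r y]; linarith
  have hd₃ : ‖c₃ - z'‖ ^ 2 ≤ 1 / 3 := by rw [μ.norm_sub_proj_sq r y]; linarith
  have h01 : c₀ ≠ c₁ := fun e => by
    have h := hlt₁; rw [e] at h; exact lt_irrefl _ h
  have h12 : c₁ ≠ c₂ := fun e => by
    have h := hlt₂; rw [e] at h; exact lt_irrefl _ h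
  have h23 : c₂ ≠ c₃ := fun e => by
    have h := hlt₃; rw [e] at h; exact lt_irrefl _ h
  have h02 : c₀ ≠ c₂ := fun e => by
    have h := hlt₂.trans hlt₁; rw [e] at h; exact lt_irrefl _ h
  have h13 : c₁ ≠ c₃ := fun e => by
    have h := hlt₃.trans hlt₂; rw [e] at h; exact lt_irrefl _ h
  have h03 : c₀ ≠ c₃ := fun e => by
    have h := (hlt₃.trans hlt₂).trans hlt₁; rw [e] at h; exact lt_irrefl _ h
  have hσ := (μ.rframe_spec r).1
  have hsep : ∀ p ∈ ({c₀, c₁, c₂, c₃} : Finset E3), ∀ p' ∈ ({c₀, c₁, c₂, c₃} : Finset E3), p ≠ p' → 1 ≤ dist p p' := by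
    intro p hp p' hp' hne
    simp only [Finset.mem_insert, Finset.mem_singleton] at hp hp'
    have hmem : ∀ p₀, p₀ = c₀ ∨ p₀ = c₁ ∨ p₀ = c₂ ∨ p₀ = c₃ → p₀ ∈ rc.S (rc.rtL r) := by
      rintro p₀ (rfl | rfl | rfl | rfl) <;> exact μ.site_mem r m _ _
    exact one_le_dist_of_mem_stacking hσ (by rw [← (μ.rframe_spec r).2.2.1]; exact hmem p hp)
      (by rw [← (μ.rframe_spec r).2.2.1]; exact hmem p' hp') hne
  have hQ : ∀ p ∈ ({c₀, c₁, c₂, c₃} : Finset E3), ‖p - z'‖ ^ 2 ≤ 1 / 3 := by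
    intro p hp
    simp only [Finset.mem_insert, Finset.mem_singleton] at hp
    rcases hp with rfl | rfl | rfl | rfl
    · exact hd₀
    · exact hd₁
    · exact hd₂
    · exact hd₃
  have hcard := card_le_three_of_norm_sub_sq_le_third {c₀, c₁, c₂, c₃} z' hsep hQ
  have h4 : ({c₀, c₁, c₂, c₃} : Finset E3).card = 4 := by
    rw [Finset.card_insert_of_notMem, Finset.card_insert_of_notMem, Finset.card_insert_of_notMem, Finset.card_singleton]
    · simpa using h23
    · simp only [Finset.mem_insert, Finset.mem_singleton, not_or]; exact ⟨h12, h13⟩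
    · simp only [Finset.mem_insert, Finset.mem_singleton, not_or]; exact ⟨h01, h02, h03⟩
  omega

/-! ### Riser layers: the opposite letter is at distance `1/√3`; shared layers: the letters coincide -/

/-- The layers of the two words at index `m`, compared through their letters. -/
theorem isSharedLayer_of_label {r : Fin rc.nr} {m q : ℤ} (hL : haggLabel (μ.rσR r) m = haggLabel (μ.rσL r) m + 3 * q) : μ.IsSharedLayer r m := by
  unfold IsSharedLayer
  ext p
  constructor
  · rintro ⟨i, j, rfl⟩
    have h := Literature.MathematicalPhysics.StatisticalMechanics.barlowPos_eq_of_haggLabel_eq (1 : ℝ) hB (i - q) (j - q) hL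
    simp only [sub_self, zero_smul, add_zero, sub_add_cancel] at h
    exact ⟨i - q, j - q, h.symm⟩
  · rintro ⟨i, j, rfl⟩
    have h := Literature.MathematicalPhysics.StatisticalMechanics.barlowPos_eq_of_haggLabel_eq (1 : ℝ) hB i j hL
    simp only [sub_self, zero_smul, add_zero] at h
    exact ⟨i + q, j + q, h⟩

/-- **In a RISER layer every `f`-site has a `g`-site at squared distance `1/3`** (a vertex of its hexagon). -/
theorem exists_siteR_dist_sq {r : Fin rc.nr} {m : ℤ} (hm : ¬ μ.IsSharedLayer r m) (i j : ℤ) :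
    ∃ i' j', dist (μ.site r m i j) (μ.siteR r m i' j') ^ 2 = 1 / 3 := by
  set Δ := haggLabel (μ.rσR r) m - haggLabel (μ.rσL r) m with hΔ
  have hdecomp : haggLabel (μ.rσR r) m = haggLabel (μ.rσL r) m + 3 * (Δ / 3) + Δ % 3 := by omega
  have hmod : Δ % 3 = 0 ∨ Δ % 3 = 1 ∨ Δ % 3 = 2 := by omega
  rcases hmod with h0 | h1 | h2
  · exfalso
    apply hm
    exact μ.isSharedLayer_of_label (q := Δ / 3) (by rw [h0, add_zero] at hdecomp; exact hdecomp)
  · -- `siteR (i − q) (j − q) = site i j + rL w`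
    refine ⟨i - Δ / 3, j - Δ / 3, ?_⟩
    have h := barlowPos_eq_of_haggLabel_eq_add (k := m) (by rw [h1] at hdecomp; exact hdecomp) (i - Δ / 3) (j - Δ / 3)
    simp only [sub_add_cancel, Int.cast_one, one_smul] at h
    have he : μ.siteR r m (i - Δ / 3) (j - Δ / 3) = μ.site r m i j + μ.rL r (barlowOffset 1) := by
      unfold siteR site; rw [h, map_add]; abel
    rw [he, dist_comm, dist_eq_norm, add_sub_cancel_left, LinearIsometryEquiv.norm_map, norm_barlowOffset_sq]
  · -- `siteR (i − q − 1) (j − q − 1) = site i j − rL w`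
    refine ⟨i - Δ / 3 - 1, j - Δ / 3 - 1, ?_⟩
    have hL : haggLabel (μ.rσR r) m = haggLabel (μ.rσL r) m + 3 * (Δ / 3 + 1) + (-1) := by rw [h2] at hdecomp; omega
    have h := barlowPos_eq_of_haggLabel_eq_add (k := m) hL (i - Δ / 3 - 1) (j - Δ / 3 - 1)
    simp only [show i - Δ / 3 - 1 + (Δ / 3 + 1) = i by ring, show j - Δ / 3 - 1 + (Δ / 3 + 1) = j by ring, Int.cast_neg, Int.cast_one,
      neg_smul, one_smul] at h
    have he : μ.siteR r m (i - Δ / 3 - 1) (j - Δ / 3 - 1) = μ.site r m i j - μ.rL r (barlowOffset 1) := by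
      unfold siteR site; rw [h, ← sub_eq_add_neg, map_sub]; abel
    rw [he, dist_eq_norm, sub_sub_cancel, LinearIsometryEquiv.norm_map, norm_barlowOffset_sq]

/-- **In a SHARED layer every `g`-site is an `f`-site.** -/
theorem exists_site_eq_siteR {r : Fin rc.nr} {m : ℤ} (hm : μ.IsSharedLayer r m) (i j : ℤ) : ∃ i' j', μ.siteR r m i j = μ.site r m i' j' := by
  have hmem : barlowPos 1 hB (μ.rσR r) m i j ∈ barlowLayer 1 hB (μ.rσL r) m := by
    have : barlowPos 1 hB (μ.rσR r) m i j ∈ barlowLayer 1 hB (μ.rσR r) m := ⟨i, j, rfl⟩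
    unfold IsSharedLayer at hm
    rw [hm]; exact this
  obtain ⟨i', j', he⟩ := hmem
  exact ⟨i', j', by unfold siteR site; rw [he]⟩

/-- **In a SHARED layer every `f`-site is a `g`-site.** -/
theorem exists_siteR_eq_site {r : Fin rc.nr} {m : ℤ} (hm : μ.IsSharedLayer r m) (i j : ℤ) : ∃ i' j', μ.site r m i j = μ.siteR r m i' j' := by
  have hmem : barlowPos 1 hB (μ.rσL r) m i j ∈ barlowLayer 1 hB (μ.rσR r) m := by
    have : barlowPos 1 hB (μ.rσL r) m i j ∈ barlowLayer 1 hB (μ.rσL r) m := ⟨i, j, rfl⟩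
    unfold IsSharedLayer at hm
    rw [← hm]; exact this
  obtain ⟨i', j', he⟩ := hmem
  exact ⟨i', j', by unfold siteR site; rw [he]⟩

end Mesh₅

end Summit.Ventures.Crystal3D.Cruxes.TextureLiminf.TexShadow

end
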